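import Mathlib
import Summits.Ventures.PercRepro2.CrossSection

/-!
# (AS3) = Reimer's slack + a correction term
(seat mine-b, cell pub-perc-repro2; conjectures/MINE-B.md §16)

For increasing events `A`, `B` on the cube `𝒫(U)` (`γ` blue, `ρ = U \ γ` red) the level-refined Reimer
statement (AS3) is `0 ≤ Φ(U; A, B) = #{A γ ∧ B ρ} − #{A □ B at γ ∧ ρ ∉ B} − #{B □ B at γ ∧ ρ ∈ A}`
(`AS3_iff_Phi_nonneg`, CrossSection.lean).  Splitting the Reimer sources `#{A □ B at γ}` by `ρ ∈ B`,

  **`Φ(U; A, B) = R(U; A, B) + c(U; A, B)`**   (`Phi_eq_rSlack_add_corr`), where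
  `R = #{A γ ∧ B ρ} − #{A □ B at γ} ≥ 0` (`rSlack`; the pinned pattern version is `reimerSlack` of IncReimer.lean) is the slack of Reimer's inequality for increasing events
  (`reimer_increasing`, mine-1) and
  `c = #{A □ B at γ ∧ ρ ∈ B} − #{B □ B at γ ∧ ρ ∈ A}` is the CORRECTION.

So (AS3) holds on every pair with `c ≥ 0` (`AS3_of_corr_nonneg`), and its content beyond Reimer's
inequality is confined to the pairs with `c < 0`: exhaustively these are 7 / 20,476 pairs with sources on
4 elements and 4,787 / 49,635,627 on 5 elements (all nested, `B` with 4–5 generators; MINE-B.md §16),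
and on every one of them `Φ ≥ 3`.  `AS3_iff_rSlack_add_corr_nonneg` is the equivalence.
-/

open Finset

namespace Summit.Ventures.PercRepro2

namespace StepZero

open ReimerCube

variable {E : Type*} [DecidableEq E]

open Classical

/-- the Reimer sources whose red side is in `B`: `#{γ ⊆ U : A □ B at γ ∧ U \ γ ∈ B}` -/
noncomputable def cX (U : Finset E) (A B : Finset E → Prop) : ℕ :=
  (U.powerset.filter (fun γ => DOcc A B γ ∧ B (U \ γ))).card

/-- all Reimer sources `#{γ ⊆ U : A □ B at γ}` -/
noncomputable def cR (U : Finset E) (A B : Finset E → Prop) : ℕ :=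
  (U.powerset.filter (fun γ => DOcc A B γ)).card

/-- the slack of Reimer's inequality for increasing events: `#{A γ ∧ B ρ} − #{A □ B at γ}` -/
noncomputable def rSlack (U : Finset E) (A B : Finset E → Prop) : ℤ :=
  (cT U A B : ℤ) - cR U A B

/-- the correction term `c(U; A, B) = #{A □ B at γ ∧ ρ ∈ B} − #{B □ B at γ ∧ ρ ∈ A}` -/
noncomputable def corr (U : Finset E) (A B : Finset E → Prop) : ℤ :=
  (cX U A B : ℤ) - cM U A B

/-- the Reimer sources split by the red side: `cR = cL + cX` -/
lemma cR_eq_cL_add_cX (U : Finset E) (A B : Finset E → Prop) :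
    cR U A B = cL U A B + cX U A B := by
  unfold cR cL cX
  rw [← Finset.card_filter_add_card_filter_not (fun γ => B (U \ γ))
    (s := U.powerset.filter (fun γ => DOcc A B γ)), Finset.filter_filter, Finset.filter_filter,
    Nat.add_comm]

/-- **The decomposition `Φ = R + c`.** -/
theorem Phi_eq_rSlack_add_corr (U : Finset E) (A B : Finset E → Prop) :
    Phi U A B = rSlack U A B + corr U A B := by
  unfold Phi rSlack corr
  rw [cR_eq_cL_add_cX]
  push_cast
  ring

/-- Reimer's inequality for increasing events: the slack is non-negative. -/
theorem rSlack_nonneg (U : Finset E) {A B : Finset E → Prop} (hA : Incr A) (hB : Incr B) :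
    0 ≤ rSlack U A B := by
  unfold rSlack cT cR
  have h := reimer_increasing U A B hA hB
  omega

/-- **(AS3) holds on every pair whose correction is non-negative** — there it is Reimer's inequality. -/
theorem AS3_of_corr_nonneg (U : Finset E) {A B : Finset E → Prop} (hA : Incr A) (hB : Incr B)
    (hc : 0 ≤ corr U A B) : AS3 U A B := by
  rw [AS3_iff_Phi_nonneg, Phi_eq_rSlack_add_corr]
  have := rSlack_nonneg U hA hB
  omega

/-- (AS3) is exactly `R + c ≥ 0`: its content beyond Reimer's inequality is `R ≥ −c` on the pairs with
`c < 0`. -/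
theorem AS3_iff_rSlack_add_corr_nonneg (U : Finset E) (A B : Finset E → Prop) :
    AS3 U A B ↔ 0 ≤ rSlack U A B + corr U A B := by
  rw [AS3_iff_Phi_nonneg, Phi_eq_rSlack_add_corr]

end StepZero

end Summit.Ventures.PercRepro2
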